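import Mathlib
import Literature.Combinatorics.Additive.TripleProductProperty

/-!
# `SnSubsetDichotomy.HyperoctahedralSubsets`, line `spherical-rank-sieve` — stub `stub_pairwisePacking`

Pairwise packing inside the hosts (crux `stmt-MatrixMultiplication-8305`, registered stub
`stub_pairwisePacking` of the lead's skeleton for line `spherical-rank-sieve`).

Let `μ₀, μ₁, μ₂` be fixed-point-free involutions of `Fin n` (`n > 0`), `C(μ_i)` their centralisers
in `S_n = Equiv.Perm (Fin n)`, and `X_i ⊆ C(μ_i)` a triple with the triple product property (tree
convention `Literature.Combinatorics.Additive.TripleProductProperty`: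
`s s'⁻¹ (t t'⁻¹) (u u'⁻¹) = 1 ⇒ s = s', t = t', u = u'`).  Then for `i ≠ j`,
`(|X₀||X₁||X₂|)² · |C(μ_i) ∩ C(μ_j)|² ≤ (n · n!)³`.

Proof.
1. *Pair injectivity* (`inv_mul_inj_of_tpp`): if `U ≠ ∅`, the triple product property of
   `(S, T, U)` makes `(x, y) ↦ x⁻¹ y` injective on `S × T` (Cohn–Umans 2003, proof of Lemma 3.1);
   the property is invariant under cyclic rotation (`tpp_rotate`), which gives the pairs
   `(T, U)` and `(U, S)` as well.
2. *Host intersection packing* (`card_mul_card_mul_natCard_inf_le`): for subgroups `H, K` of a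
   finite group and `A ⊆ H`, `B ⊆ K` on which `(x, y) ↦ x⁻¹ y` is injective, the map
   `A × B × (H ∩ K) → H × K`, `(x, y, h) ↦ (h x, h y)` is injective (`(hx)⁻¹(hy) = x⁻¹y` recovers
   `(x, y)` and then `h`), so `|A| |B| |H ∩ K| ≤ |H| |K|`; with `|X_k| ≤ |C(μ_k)|` for the third
   index this gives `|X₀||X₁||X₂| · |C(μ_i) ∩ C(μ_j)| ≤ |C(μ₀)||C(μ₁)||C(μ₂)|`
   (`vol_mul_natCard_inf_le`; an empty `X_k` makes the left side `0`).
3. *Host size* (`natCard_centralizer_fpf_involution`): a fixed-point-free involution of `Fin n`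
   has cycle type `2^m` with `n = 2m` (`Equiv.Perm.cycleType_prime_order`,
   `Equiv.Perm.sum_cycleType`), so `|C(μ)| = 2^m · m!` (`Equiv.Perm.nat_card_centralizer`), and
   `(2^m m!)² = 4^m (m!)² ≤ 2m · binom(2m, m) · (m!)² = n · n!`
   (`Nat.four_pow_le_two_mul_self_mul_centralBinom`; `two_pow_mul_factorial_sq_le`).
4. Squaring step 2 and inserting step 3 three times gives the claim.

References: H. Cohn, C. Umans, *A group-theoretic approach to fast matrix multiplication*,
FOCS 2003, Lemma 3.1 (pairwise packing `|X||Y| ≤ |G|`); the relative (host-intersection) form is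
this line's.
-/

namespace Summit.MatrixMultiplication.MatrixMultiplication.Theorems.HyperoctahedralSubsets

open Literature.Combinatorics.Additive

namespace PairwisePacking

/-! ## Pair injectivity from the triple product property -/

/-- The triple product property is invariant under cyclic rotation of the three sets
(`q₂ q₃ q₁ = 1 ⇔ q₁ q₂ q₃ = 1` by conjugation). [folklore] -/
theorem tpp_rotate {P : Type*} [Group P] {S T U : Finset P}
    (h : TripleProductProperty S T U) : TripleProductProperty T U S := by
  -- adapted from `Literature.Combinatorics.Additive.TripleProductProperty.rotate`
  intro t ht t' ht' u hu u' hu' s hs s' hs' heq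
  have heq' : s * s'⁻¹ * (t * t'⁻¹) * (u * u'⁻¹) = 1 :=
    calc s * s'⁻¹ * (t * t'⁻¹) * (u * u'⁻¹)
        = s * s'⁻¹ * (t * t'⁻¹ * (u * u'⁻¹) * (s * s'⁻¹)) * (s * s'⁻¹)⁻¹ := by group
      _ = 1 := by rw [heq]; group
  obtain ⟨hs1, ht1, hu1⟩ := h s hs s' hs' t ht t' ht' u hu u' hu' heq'
  exact ⟨ht1, hu1, hs1⟩

/-- **Pair injectivity** (Cohn–Umans 2003, proof of Lemma 3.1): if `(S, T, U)` has the triple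
product property and `U` is nonempty, then `(x, y) ↦ x⁻¹ y` is injective on `S × T`:
`x⁻¹ y = x'⁻¹ y'` gives the triple-product relation `x' x⁻¹ · y y'⁻¹ · u u⁻¹ = 1`. [folklore] -/
theorem inv_mul_inj_of_tpp {P : Type*} [Group P] {S T U : Finset P}
    (h : TripleProductProperty S T U) (hU : U.Nonempty) :
    ∀ x ∈ S, ∀ x' ∈ S, ∀ y ∈ T, ∀ y' ∈ T, x⁻¹ * y = x'⁻¹ * y' → x = x' ∧ y = y' := by
  -- adapted from `Literature.Combinatorics.Additive.TripleProductProperty.card_mul_sq_le`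
  obtain ⟨c, hc⟩ := hU
  intro x hx x' hx' y hy y' hy' he
  have h0 : x' * x⁻¹ * (y * y'⁻¹) * (c * c⁻¹) = 1 :=
    calc x' * x⁻¹ * (y * y'⁻¹) * (c * c⁻¹) = x' * (x⁻¹ * y) * y'⁻¹ := by group
      _ = 1 := by rw [he]; group
  obtain ⟨h1, h2, -⟩ := h x' hx' x hx y hy y' hy' c hc c hc h0
  exact ⟨h1.symm, h2⟩

/-! ## Packing two sets together with a host intersection -/

/-- **Host intersection packing.**  In a finite group `P` let `H, K` be subgroups and `A ⊆ H`,
`B ⊆ K` finite sets on which `(x, y) ↦ x⁻¹ y` is injective.  Then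
`|A| · |B| · |H ∩ K| ≤ |H| · |K|`: the map `A × B × (H ∩ K) → H × K`, `(x, y, h) ↦ (h x, h y)` is
injective, since `(h x)⁻¹ (h y) = x⁻¹ y` recovers `(x, y)` and then `h`. [folklore] -/
theorem card_mul_card_mul_natCard_inf_le {P : Type*} [Group P] [Finite P] {H K : Subgroup P}
    {A B : Finset P} (hA : ∀ a ∈ A, a ∈ H) (hB : ∀ b ∈ B, b ∈ K)
    (hinj : ∀ x ∈ A, ∀ x' ∈ A, ∀ y ∈ B, ∀ y' ∈ B, x⁻¹ * y = x'⁻¹ * y' → x = x' ∧ y = y') :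
    A.card * B.card * Nat.card ↥(H ⊓ K) ≤ Nat.card ↥H * Nat.card ↥K := by
  obtain ⟨f, hf⟩ : ∃ f : (↥A × ↥B) × ↥(H ⊓ K) → ↥H × ↥K, ∀ p, f p =
      (⟨p.2.1 * p.1.1.1, H.mul_mem (Subgroup.mem_inf.1 p.2.2).1 (hA _ p.1.1.2)⟩,
        ⟨p.2.1 * p.1.2.1, K.mul_mem (Subgroup.mem_inf.1 p.2.2).2 (hB _ p.1.2.2)⟩) :=
    ⟨_, fun _ => rfl⟩
  have hf_inj : Function.Injective f := by
    rintro ⟨⟨⟨x, hx⟩, ⟨y, hy⟩⟩, ⟨g, hg⟩⟩ ⟨⟨⟨x', hx'⟩, ⟨y', hy'⟩⟩, ⟨g', hg'⟩⟩ he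
    simp only [hf, Prod.mk.injEq, Subtype.mk.injEq] at he
    obtain ⟨e1, e2⟩ := he
    have key : x⁻¹ * y = x'⁻¹ * y' :=
      calc x⁻¹ * y = (g * x)⁻¹ * (g * y) := by group
        _ = (g' * x')⁻¹ * (g' * y') := by rw [e1, e2]
        _ = x'⁻¹ * y' := by group
    obtain ⟨rfl, rfl⟩ := hinj x hx x' hx' y hy y' hy' key
    obtain rfl : g = g' := mul_right_cancel e1
    rfl
  have hle := Nat.card_le_card_of_injective f hf_inj
  simp only [Nat.card_prod, Nat.card_eq_finsetCard] at hle
  exact hle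

/-- **Volume times host intersection.**  For subgroups `C₀, C₁, C₂` of a finite group and a triple
`X_i ⊆ C_i` with the triple product property, `|X₀||X₁||X₂| · |C_i ∩ C_j| ≤ |C₀||C₁||C₂|` for all
`i ≠ j`: pack `X_i, X_j` together with `C_i ∩ C_j` into `C_i × C_j`
(`card_mul_card_mul_natCard_inf_le`, the injectivity coming from `inv_mul_inj_of_tpp` after a
cyclic rotation) and bound the third factor by `|X_k| ≤ |C_k|`; if some `X_k` is empty the left
side vanishes. [folklore] -/
theorem vol_mul_natCard_inf_le {P : Type*} [Group P] [Finite P] (C : Fin 3 → Subgroup P)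
    (X : Fin 3 → Finset P) (hsub : ∀ l, ∀ σ ∈ X l, σ ∈ C l)
    (hTPP : TripleProductProperty (X 0) (X 1) (X 2)) :
    ∀ i j : Fin 3, i ≠ j →
      (X 0).card * (X 1).card * (X 2).card * Nat.card ↥(C i ⊓ C j) ≤
        Nat.card ↥(C 0) * Nat.card ↥(C 1) * Nat.card ↥(C 2) := by
  have hsingle : ∀ l, (X l).card ≤ Nat.card ↥(C l) := fun l => by
    rw [← Nat.card_eq_finsetCard]
    exact Nat.card_le_card_of_injective (fun x : ↥(X l) => (⟨x.1, hsub l x.1 x.2⟩ : ↥(C l)))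
      fun a b h => Subtype.ext (by simpa using congrArg Subtype.val h)
  intro i j hij
  rcases (X 0).eq_empty_or_nonempty with h0 | h0
  · simp [h0]
  rcases (X 1).eq_empty_or_nonempty with h1 | h1
  · simp [h1]
  rcases (X 2).eq_empty_or_nonempty with h2 | h2
  · simp [h2]
  have p01 := card_mul_card_mul_natCard_inf_le (hsub 0) (hsub 1) (inv_mul_inj_of_tpp hTPP h2)
  have p12 := card_mul_card_mul_natCard_inf_le (hsub 1) (hsub 2)
    (inv_mul_inj_of_tpp (tpp_rotate hTPP) h0)
  have p20 := card_mul_card_mul_natCard_inf_le (hsub 2) (hsub 0)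
    (inv_mul_inj_of_tpp (tpp_rotate (tpp_rotate hTPP)) h1)
  rw [inf_comm] at p20
  -- the three unordered pairs
  have q01 : (X 0).card * (X 1).card * (X 2).card * Nat.card ↥(C 0 ⊓ C 1) ≤
      Nat.card ↥(C 0) * Nat.card ↥(C 1) * Nat.card ↥(C 2) :=
    calc (X 0).card * (X 1).card * (X 2).card * Nat.card ↥(C 0 ⊓ C 1)
        = (X 0).card * (X 1).card * Nat.card ↥(C 0 ⊓ C 1) * (X 2).card := by ring
      _ ≤ Nat.card ↥(C 0) * Nat.card ↥(C 1) * Nat.card ↥(C 2) := Nat.mul_le_mul p01 (hsingle 2)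
  have q02 : (X 0).card * (X 1).card * (X 2).card * Nat.card ↥(C 0 ⊓ C 2) ≤
      Nat.card ↥(C 0) * Nat.card ↥(C 1) * Nat.card ↥(C 2) :=
    calc (X 0).card * (X 1).card * (X 2).card * Nat.card ↥(C 0 ⊓ C 2)
        = (X 2).card * (X 0).card * Nat.card ↥(C 0 ⊓ C 2) * (X 1).card := by ring
      _ ≤ Nat.card ↥(C 2) * Nat.card ↥(C 0) * Nat.card ↥(C 1) := Nat.mul_le_mul p20 (hsingle 1)
      _ = Nat.card ↥(C 0) * Nat.card ↥(C 1) * Nat.card ↥(C 2) := by ring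
  have q12 : (X 0).card * (X 1).card * (X 2).card * Nat.card ↥(C 1 ⊓ C 2) ≤
      Nat.card ↥(C 0) * Nat.card ↥(C 1) * Nat.card ↥(C 2) :=
    calc (X 0).card * (X 1).card * (X 2).card * Nat.card ↥(C 1 ⊓ C 2)
        = (X 1).card * (X 2).card * Nat.card ↥(C 1 ⊓ C 2) * (X 0).card := by ring
      _ ≤ Nat.card ↥(C 1) * Nat.card ↥(C 2) * Nat.card ↥(C 0) := Nat.mul_le_mul p12 (hsingle 0)
      _ = Nat.card ↥(C 0) * Nat.card ↥(C 1) * Nat.card ↥(C 2) := by ring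
  fin_cases i <;> fin_cases j
  · exact absurd rfl hij
  · exact q01
  · exact q02
  · show (X 0).card * (X 1).card * (X 2).card * Nat.card ↥(C 1 ⊓ C 0) ≤ _
    rw [inf_comm]; exact q01
  · exact absurd rfl hij
  · exact q12
  · show (X 0).card * (X 1).card * (X 2).card * Nat.card ↥(C 2 ⊓ C 0) ≤ _
    rw [inf_comm]; exact q02
  · show (X 0).card * (X 1).card * (X 2).card * Nat.card ↥(C 2 ⊓ C 1) ≤ _
    rw [inf_comm]; exact q12
  · exact absurd rfl hij

/-! ## The size of the host `C(μ)` -/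

/-- **Centraliser of a fixed-point-free involution.**  If `μ ∈ S_n` (`n > 0`) satisfies `μ² = 1`
and has no fixed point, then `μ` has order `2`, its cycle type is `2^m` with `n = 2m`
(`Equiv.Perm.cycleType_prime_order`, `Equiv.Perm.sum_cycleType`), and its centraliser has
`(n - n)! · 2^m · m! = 2^m · m!` elements (`Equiv.Perm.nat_card_centralizer`). [folklore] -/
theorem natCard_centralizer_fpf_involution {n : ℕ} (hn : 0 < n) {μ : Equiv.Perm (Fin n)}
    (h1 : μ * μ = 1) (h2 : ∀ x, μ x ≠ x) :
    ∃ m : ℕ, n = 2 * m ∧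
      Nat.card ↥(Subgroup.centralizer ({μ} : Set (Equiv.Perm (Fin n)))) =
        2 ^ m * m.factorial := by
  have hne : μ ≠ 1 := fun h => h2 ⟨0, hn⟩ (by simp [h])
  have hord : orderOf μ = 2 := orderOf_eq_prime (by rw [pow_two, h1]) hne
  obtain ⟨k, hk⟩ := Equiv.Perm.cycleType_prime_order (σ := μ) (by rw [hord]; exact Nat.prime_two)
  rw [hord] at hk
  have hsupp : μ.support = Finset.univ :=
    Finset.eq_univ_iff_forall.2 fun x => Equiv.Perm.mem_support.2 (h2 x)
  have hsum : μ.cycleType.sum = n := by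
    rw [Equiv.Perm.sum_cycleType, hsupp, Finset.card_univ, Fintype.card_fin]
  have hn2 : n = 2 * (k + 1) := by
    have h := hsum
    rw [hk, Multiset.sum_replicate, smul_eq_mul] at h
    omega
  refine ⟨k + 1, hn2, ?_⟩
  rw [Equiv.Perm.nat_card_centralizer, hsum, Fintype.card_fin, Nat.sub_self, Nat.factorial_zero,
    one_mul, hk, Multiset.prod_replicate, Multiset.toFinset_replicate,
    if_neg (show ¬ (k + 1 = 0) by omega), Finset.prod_singleton, Multiset.count_replicate_self]

/-- The arithmetic behind `|C(μ)|² ≤ n · n!`: for `m > 0`,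
`(2^m · m!)² = 4^m · (m!)² ≤ 2m · binom(2m, m) · (m!)² = 2m · (2m)!`
(`Nat.four_pow_le_two_mul_self_mul_centralBinom`, `Nat.choose_mul_factorial_mul_factorial`).
[folklore] -/
theorem two_pow_mul_factorial_sq_le {m : ℕ} (hm : 0 < m) :
    (2 ^ m * m.factorial) ^ 2 ≤ 2 * m * (2 * m).factorial := by
  have h4 : 4 ^ m ≤ 2 * m * Nat.centralBinom m := Nat.four_pow_le_two_mul_self_mul_centralBinom m hm
  have hcb : Nat.centralBinom m * (m.factorial * m.factorial) = (2 * m).factorial := by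
    have h := Nat.choose_mul_factorial_mul_factorial (n := 2 * m) (k := m) (by omega)
    rw [show 2 * m - m = m by omega] at h
    rw [Nat.centralBinom_eq_two_mul_choose, ← h, mul_assoc]
  have h22 : (2 : ℕ) ^ m * 2 ^ m = 4 ^ m := by
    rw [← mul_pow]; norm_num
  calc (2 ^ m * m.factorial) ^ 2 = 2 ^ m * 2 ^ m * (m.factorial * m.factorial) := by ring
    _ = 4 ^ m * (m.factorial * m.factorial) := by rw [h22]
    _ ≤ 2 * m * Nat.centralBinom m * (m.factorial * m.factorial) := Nat.mul_le_mul_right _ h4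
    _ = 2 * m * (2 * m).factorial := by rw [mul_assoc (2 * m), hcb]

/-- **Host square bound**: for a fixed-point-free involution `μ ∈ S_n` (`n > 0`),
`|C(μ)|² ≤ n · n!` (`natCard_centralizer_fpf_involution` and `two_pow_mul_factorial_sq_le`).
[folklore] -/
theorem natCard_centralizer_sq_le {n : ℕ} (hn : 0 < n) {μ : Equiv.Perm (Fin n)}
    (h1 : μ * μ = 1) (h2 : ∀ x, μ x ≠ x) :
    Nat.card ↥(Subgroup.centralizer ({μ} : Set (Equiv.Perm (Fin n)))) ^ 2 ≤ n * n.factorial := by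
  obtain ⟨m, hnm, hcard⟩ := natCard_centralizer_fpf_involution hn h1 h2
  rw [hcard, hnm]
  exact two_pow_mul_factorial_sq_le (by omega)

end PairwisePacking

open PairwisePacking in
/-- **Stub `stub_pairwisePacking` — pairwise packing inside the hosts** (line
`spherical-rank-sieve` of crux `SnSubsetDichotomy.HyperoctahedralSubsets`,
stmt-MatrixMultiplication-8305).  For fixed-point-free involutions `μ₀, μ₁, μ₂` of `Fin n` (`n > 0`),
sets `X_i` of permutations commuting with `μ_i` having the triple product property, and `i ≠ j`:
`(|X₀||X₁||X₂|)² · |C(μ_i) ⊓ C(μ_j)|² ≤ (n · n!)³`, where `C(μ) = Subgroup.centralizer {μ}`.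
Proof: `|X₀||X₁||X₂| · |C(μ_i) ⊓ C(μ_j)| ≤ |C(μ₀)||C(μ₁)||C(μ₂)|` (`vol_mul_natCard_inf_le`), square,
and use `|C(μ_l)|² ≤ n · n!` (`natCard_centralizer_sq_le`) three times. [folklore] -/
theorem stub_pairwisePacking : ∀ (n : ℕ), 0 < n → ∀ (μ : Fin 3 → Equiv.Perm (Fin n)) (X : Fin 3 → Finset (Equiv.Perm (Fin n))), (∀ i, μ i * μ i = 1 ∧ ∀ x, μ i x ≠ x) → (∀ i, ∀ σ ∈ X i, σ * μ i = μ i * σ) → Literature.Combinatorics.Additive.TripleProductProperty (X 0) (X 1) (X 2) → ∀ i j : Fin 3, i ≠ j → ((X 0).card * (X 1).card * (X 2).card) ^ 2 * (Nat.card ↥((Subgroup.centralizer {μ i} : Subgroup (Equiv.Perm (Fin n))) ⊓ Subgroup.centralizer {μ j})) ^ 2 ≤ (n * n.factorial) ^ 3 := by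
  intro n hn μ X hμ hX hTPP i j hij
  have hsub : ∀ l, ∀ σ ∈ X l, σ ∈ Subgroup.centralizer ({μ l} : Set (Equiv.Perm (Fin n))) :=
    fun l σ hσ => Subgroup.mem_centralizer_singleton_iff.2 (hX l σ hσ)
  have key : (X 0).card * (X 1).card * (X 2).card *
      Nat.card ↥(Subgroup.centralizer ({μ i} : Set (Equiv.Perm (Fin n))) ⊓
        Subgroup.centralizer {μ j}) ≤
      Nat.card ↥(Subgroup.centralizer ({μ 0} : Set (Equiv.Perm (Fin n)))) *
        Nat.card ↥(Subgroup.centralizer ({μ 1} : Set (Equiv.Perm (Fin n)))) *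
        Nat.card ↥(Subgroup.centralizer ({μ 2} : Set (Equiv.Perm (Fin n)))) :=
    vol_mul_natCard_inf_le (fun l => Subgroup.centralizer ({μ l} : Set (Equiv.Perm (Fin n)))) X
      hsub hTPP i j hij
  have hh : ∀ l, Nat.card ↥(Subgroup.centralizer ({μ l} : Set (Equiv.Perm (Fin n)))) ^ 2 ≤
      n * n.factorial :=
    fun l => natCard_centralizer_sq_le hn (hμ l).1 (hμ l).2
  calc ((X 0).card * (X 1).card * (X 2).card) ^ 2 *
        Nat.card ↥(Subgroup.centralizer ({μ i} : Set (Equiv.Perm (Fin n))) ⊓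
          Subgroup.centralizer {μ j}) ^ 2
      = ((X 0).card * (X 1).card * (X 2).card *
          Nat.card ↥(Subgroup.centralizer ({μ i} : Set (Equiv.Perm (Fin n))) ⊓
            Subgroup.centralizer {μ j})) ^ 2 := (mul_pow _ _ 2).symm
    _ ≤ (Nat.card ↥(Subgroup.centralizer ({μ 0} : Set (Equiv.Perm (Fin n)))) *
          Nat.card ↥(Subgroup.centralizer ({μ 1} : Set (Equiv.Perm (Fin n)))) *
          Nat.card ↥(Subgroup.centralizer ({μ 2} : Set (Equiv.Perm (Fin n))))) ^ 2 :=
        Nat.pow_le_pow_left key 2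
    _ = Nat.card ↥(Subgroup.centralizer ({μ 0} : Set (Equiv.Perm (Fin n)))) ^ 2 *
          Nat.card ↥(Subgroup.centralizer ({μ 1} : Set (Equiv.Perm (Fin n)))) ^ 2 *
          Nat.card ↥(Subgroup.centralizer ({μ 2} : Set (Equiv.Perm (Fin n)))) ^ 2 := by
        rw [mul_pow, mul_pow]
    _ ≤ n * n.factorial * (n * n.factorial) * (n * n.factorial) :=
        Nat.mul_le_mul (Nat.mul_le_mul (hh 0) (hh 1)) (hh 2)
    _ = (n * n.factorial) ^ 3 := by ring

end Summit.MatrixMultiplication.MatrixMultiplication.Theorems.HyperoctahedralSubsets
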